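import Literature.NumberTheory.Rogawski1990.ArchChartOrbGTensorOverPlaces   -- (F) (this seat, p852031): `chartOrbG_eq_prod_mul_integral_pi_mul_integral_of_tensor`; brings ★ (J-iso)^T, ★ (J-iso), ★ (A1), ★ `ArchInnerFormChartOrbLocal`
import Mathlib.MeasureTheory.Integral.Pi
import HarnessLib

/-!
# The `D`-side of a tensor, place by place: `∫_{Π_{w∈D} U(α)_w} Π_w b_w(g_w γ_w g_w⁻¹) d(⊗ ν′_w) = Π_{w∈D} chartOrbGLoc_w(b_w)` at compact-chart places
# («(F1′) WHOLE-GROUP ↔ `chartOrbGLoc` AT A COMPACT PLACE»; Folland 1995 §2.2, §2.6 (2.52); Rogawski 1990 §8.2–8.3; Borel–Jacquet 1979 §4.1)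

Topic `NumberTheory/Rogawski1990`; namespace `Literature.NumberTheory.Automorphic.UnitaryGroup`.  THEOREMS ONLY (no `def`, no instance, no notation, no axiom, no named fact,
no `sorry`).  Cell `pub/hodgecm-mathlib`, crux H413 (`stmt-HodgeConjecture-24833`), F0∕P3c line LH2 «N8-INNER», ROAD B «EULER–POINCARÉ ROAD» (dealer LH2-plan (g1), brick (F1′)
dealt 2026-09-02T16:20:47Z with (F) «=»), seat F0P2-p02 (g21).  Count-neutral measure-theoretic bookkeeping: nothing here closes an organ.

THE MATHEMATICS.  (F) `chartOrbG_eq_prod_mul_integral_pi_mul_integral_of_tensor` reads a tensor `a′ = b(g_D) · u` as `(Π_{I} t(B′)) · (∫_{Π_{D} U(α)_w} b(g γ_D(c) g⁻¹) d⊗ν′) · U_c`.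
When `b` is itself a TENSOR OF ONE-PLACE FUNCTIONS `b(x) = Π_{w∈D} b_w(x_w)` (the generators of ROAD B), Fubini on the finite product (Mathlib `integral_fintype_prod_eq_prod`)
and the one-place dictionary ★ `chartOrbGLoc_eq_integral_of_not_mem` («at `w ∉ S′` the local functional IS the whole-group orbital integral», NO mass factor: the box prefactor
`dt′_w(B′) = dt′_w(T′)` cancels exactly) give
* `integral_pi_prod_conj_eq_prod_integral` — `∫_{Π_{p} U(α)_w} Π_w b_w(g_w γ_w(c) g_w⁻¹) d(⊗_{p} ν′_w) = Π_{w : p} ∫_{U(α)_w} b_w(h γ_w(c) h⁻¹) dν′_w(h)` (any `p`);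
* **`integral_pi_prod_conj_eq_prod_chartOrbGLoc`** — `= Π_{w : p} chartOrbGLoc L α w S′ ν′_w b_w (c w)` when `p w → w ∉ S′` and the `b_w` are measurable (factor EXACTLY `1`);
* **`chartOrbG_eq_prod_chartOrbGLoc_mul_of_tensor`** — (F) + the above: `chartOrbG ν′ S′ a′ c = (Π_{w : p} chartOrbGLoc_w(b_w)(c w)) · ((Π_{¬p} t(B′)) · U_c)`, the «D one-place
  readings» of (12′) §2 as literal `chartOrbGLoc` factors times the `I`-side reading `U_c` of `u(γ_D(c), ·)`.
HONEST LABEL: HC_CM is proved only modulo the 7 printed citations (2 remaining: hLiu418 = `stmt-HodgeConjecture-24832`, h413 = `stmt-HodgeConjecture-24833`) until rung 0 closes;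
this file moves no row of the books.

## References
* [Folland1995] G. B. Folland, *A Course in Abstract Harmonic Analysis* (1995), §2.2 (product measures, Fubini), §2.6 (2.52).
* [Rogawski1990] J. D. Rogawski, *Automorphic Representations of Unitary Groups in Three Variables*, Ann. of Math. Stud. 123 (1990), §8.2 p. 122, §8.3 p. 124.
* [BorelJacquet1979] A. Borel, H. Jacquet, *Automorphic forms and automorphic representations*, PSPM 33.1 (1979), §4.1 (product test functions on `G_∞ = Π_v G(F_v)`).
-/

set_option autoImplicit false

noncomputable section

open MeasureTheory MeasureTheory.Measure NumberField NumberField.InfinitePlace Matrix Complex Topology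
open Literature.MeasureTheory.Group Literature.NumberTheory.Rogawski1990
open scoped MatrixGroups Matrix Classical ENNReal NNReal

namespace Literature.NumberTheory.Automorphic.UnitaryGroup

section TensorLoc

variable (L : Type) [Field L] [NumberField L] [IsCMField L] (α : Fin 3 → L) (S' : Finset {w : InfinitePlace L // IsComplex w})
  [∀ w : {w : InfinitePlace L // IsComplex w}, MeasurableSpace ↥(archLocal L 3 (Matrix.diagonal α) w)]
  [∀ w : {w : InfinitePlace L // IsComplex w}, BorelSpace ↥(archLocal L 3 (Matrix.diagonal α) w)]
  [∀ w : {w : InfinitePlace L // IsComplex w}, LocallyCompactSpace ↥(archLocal L 3 (Matrix.diagonal α) w)]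
  [∀ w : {w : InfinitePlace L // IsComplex w}, SecondCountableTopology ↥(archLocal L 3 (Matrix.diagonal α) w)]
  (ν'w : ∀ w : {w : InfinitePlace L // IsComplex w}, Measure ↥(archLocal L 3 (Matrix.diagonal α) w)) [∀ w, (ν'w w).IsHaarMeasure] [∀ w, (ν'w w).IsMulRightInvariant]
  (p : {w : InfinitePlace L // IsComplex w} → Prop) [DecidablePred p]
  [Fintype {w : {w : InfinitePlace L // IsComplex w} // p w}] [Fintype {w : {w : InfinitePlace L // IsComplex w} // ¬ p w}]

/-! ## §1 Fubini on the finite product of the isolated groups -/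

omit [∀ w : {w : InfinitePlace L // IsComplex w}, BorelSpace ↥(archLocal L 3 (Matrix.diagonal α) w)]
  [∀ w : {w : InfinitePlace L // IsComplex w}, LocallyCompactSpace ↥(archLocal L 3 (Matrix.diagonal α) w)]
  [∀ w : {w : InfinitePlace L // IsComplex w}, SecondCountableTopology ↥(archLocal L 3 (Matrix.diagonal α) w)]
  [∀ w, (ν'w w).IsHaarMeasure] [∀ w, (ν'w w).IsMulRightInvariant] [Fintype {w : {w : InfinitePlace L // IsComplex w} // ¬ p w}]
  [NumberField L] [IsCMField L] [DecidablePred p] in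
/-- **A tensor of one-place functions integrates place by place over `Π_{p} U(α)_w`** at the orbit `γ_w(c)` (Mathlib `integral_fintype_prod_eq_prod`; σ-finite factors).
[cite: Folland1995, §2.2] [cite: BorelJacquet1979, §4.1] -/
theorem integral_pi_prod_conj_eq_prod_integral [∀ w, SigmaFinite (ν'w w)] (c : {w : InfinitePlace L // IsComplex w} → Fin 3 → ℝ)
    (bw : ∀ w : {w : {w : InfinitePlace L // IsComplex w} // p w}, ↥(archLocal L 3 (Matrix.diagonal α) w.1) → ℂ) :
    (∫ g : (∀ w : {w : {w : InfinitePlace L // IsComplex w} // p w}, ↥(archLocal L 3 (Matrix.diagonal α) w.1)),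
        ∏ w, bw w (g w * gprimeBlockAt L α w.1 S' (c w.1) * (g w)⁻¹) ∂(Measure.pi fun w : {w : {w : InfinitePlace L // IsComplex w} // p w} => ν'w w.1)) =
      ∏ w : {w : {w : InfinitePlace L // IsComplex w} // p w}, ∫ h, bw w (h * gprimeBlockAt L α w.1 S' (c w.1) * h⁻¹) ∂(ν'w w.1) :=
  integral_fintype_prod_eq_prod (fun (w : {w : {w : InfinitePlace L // IsComplex w} // p w}) (h : ↥(archLocal L 3 (Matrix.diagonal α) w.1)) =>
    bw w (h * gprimeBlockAt L α w.1 S' (c w.1) * h⁻¹))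

omit [Fintype {w : {w : InfinitePlace L // IsComplex w} // ¬ p w}] [DecidablePred p] in
/-- **(F1′) WHOLE-GROUP ↔ `chartOrbGLoc` AT COMPACT PLACES**: for `p w → w ∉ S′` (compact-chart places) and measurable one-place functions `b_w`,
`∫_{Π_{p} U(α)_w} Π_w b_w(g_w γ_w(c) g_w⁻¹) d(⊗_{p} ν′_w) = Π_{w : p} chartOrbGLoc L α w S′ ν′_w b_w (c w)` — the factor is EXACTLY `1` (★ `chartOrbGLoc_eq_integral_of_not_mem`: the box
prefactor `dt′_w(B′_w) = dt′_w(T′_w)` cancels the compact-quotient normalisation). [cite: Rogawski1990, §8.2 p. 122; §8.3 p. 124] [cite: Folland1995, §2.6 (2.52)] [cite: BorelJacquet1979, §4.1] -/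
theorem integral_pi_prod_conj_eq_prod_chartOrbGLoc (hα : ∀ i, α i ≠ 0) (hS' : ∀ w, w ∈ S' → w ∈ splitChartPlaces L α) (hp : ∀ w, p w → w ∉ S')
    (c : {w : InfinitePlace L // IsComplex w} → Fin 3 → ℝ)
    (bw : ∀ w : {w : {w : InfinitePlace L // IsComplex w} // p w}, ↥(archLocal L 3 (Matrix.diagonal α) w.1) → ℂ) (hbw : ∀ w, Measurable (bw w)) :
    (∫ g : (∀ w : {w : {w : InfinitePlace L // IsComplex w} // p w}, ↥(archLocal L 3 (Matrix.diagonal α) w.1)),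
        ∏ w, bw w (g w * gprimeBlockAt L α w.1 S' (c w.1) * (g w)⁻¹) ∂(Measure.pi fun w : {w : {w : InfinitePlace L // IsComplex w} // p w} => ν'w w.1)) =
      ∏ w : {w : {w : InfinitePlace L // IsComplex w} // p w}, chartOrbGLoc L α w.1 S' (ν'w w.1) (bw w) (c w.1) := by
  rw [integral_pi_prod_conj_eq_prod_integral L α S' ν'w p c bw]
  exact Finset.prod_congr rfl fun w _ => (chartOrbGLoc_eq_integral_of_not_mem L α w.1 S' (ν'w w.1) hα hS' (hp w.1 w.2) (bw w) (hbw w) (c w.1)).symm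

/-! ## §2 The global family of a tensor whose `D`-side is a tensor of one-place generators -/

variable [MeasurableSpace ↥(arch (↥(maximalRealSubfield L)) L (IsCMField.complexConj L) 3 (Matrix.diagonal α))]
  [BorelSpace ↥(arch (↥(maximalRealSubfield L)) L (IsCMField.complexConj L) 3 (Matrix.diagonal α))]
  [∀ w : {w : InfinitePlace L // IsComplex w}, MeasurableSpace (↥(archLocal L 3 (Matrix.diagonal α) w) ⧸ chartTorusGLoc L α w S')]
  [∀ w : {w : InfinitePlace L // IsComplex w}, BorelSpace (↥(archLocal L 3 (Matrix.diagonal α) w) ⧸ chartTorusGLoc L α w S')]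
  (ν' : Measure ↥(arch (↥(maximalRealSubfield L)) L (IsCMField.complexConj L) 3 (Matrix.diagonal α))) [ν'.IsHaarMeasure] [ν'.IsMulRightInvariant]
  (hν : ν' = (Measure.pi ν'w).map (archPiEquivCM 3 L (Matrix.diagonal α)).symm)
  (t : ∀ w : {w : InfinitePlace L // IsComplex w}, Measure ↥(chartTorusGLoc L α w S')) [∀ w, (t w).IsHaarMeasure] [∀ w, (t w).IsInvInvariant]

include hν in
/-- **ROAD B's REGION READER**: a test function that is, in the product coordinates, `(Π_{w : p} b_w(x_w)) · u(x, y)` with measurable one-place generators `b_w` at the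
COMPACT-chart places `p` (`hp : p w → w ∉ S′`) and `u` invariant under conjugation of the `p`-coordinates at the orbit, has
`chartOrbG ν′ S′ a′ c = (Π_{w : p} chartOrbGLoc L α w S′ ν′_w b_w (c w)) · ((Π_{w′ : ¬p} t_{w′}(B′_{w′})) · ∫_{Π_{¬p}(U_{w′}⧸T′_{w′})} u(e⁻¹((γ_w(c))_{p}, (ḃγḃ⁻¹)_{¬p})) d(⊗_{¬p} ν′_{w′}∕t_{w′}))`
— literal `chartOrbGLoc` factors at the `D`-places times the `I`-side chart-orbital reading of `u(γ_D(c), ·)` ((F) + (F1′)).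
[cite: Rogawski1990, §8.2 p. 122; §8.3 p. 124] [cite: Folland1995, §2.2; §2.6 (2.52)] [cite: BorelJacquet1979, §4.1] -/
theorem chartOrbG_eq_prod_chartOrbGLoc_mul_of_tensor (hα : ∀ i, α i ≠ 0) (hS' : ∀ w, w ∈ S' → w ∈ splitChartPlaces L α)
    (hp : ∀ w, p w → w ∉ S')
    {c : {w : InfinitePlace L // IsComplex w} → Fin 3 → ℝ} (hc : c ∈ ArchCartan.RegG S')
    {a' : ↥(arch (↥(maximalRealSubfield L)) L (IsCMField.complexConj L) 3 (Matrix.diagonal α)) → ℂ} (ha'c : Continuous a') (ha's : HasCompactSupport a')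
    (bw : ∀ w : {w : {w : InfinitePlace L // IsComplex w} // p w}, ↥(archLocal L 3 (Matrix.diagonal α) w.1) → ℂ) (hbw : ∀ w, Measurable (bw w))
    (u : ↥(arch (↥(maximalRealSubfield L)) L (IsCMField.complexConj L) 3 (Matrix.diagonal α)) → ℂ)
    (hf : ∀ (x : ∀ w : {w : {w : InfinitePlace L // IsComplex w} // p w}, ↥(archLocal L 3 (Matrix.diagonal α) w.1))
      (y : ∀ w' : {w : {w : InfinitePlace L // IsComplex w} // ¬ p w}, ↥(archLocal L 3 (Matrix.diagonal α) w'.1)),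
      a' ((archPiEquivCM 3 L (Matrix.diagonal α)).symm
        ((MeasurableEquiv.piEquivPiSubtypeProd (fun w : {w : InfinitePlace L // IsComplex w} => ↥(archLocal L 3 (Matrix.diagonal α) w)) p).symm (x, y))) =
      (∏ w, bw w (x w)) * u ((archPiEquivCM 3 L (Matrix.diagonal α)).symm
        ((MeasurableEquiv.piEquivPiSubtypeProd (fun w : {w : InfinitePlace L // IsComplex w} => ↥(archLocal L 3 (Matrix.diagonal α) w)) p).symm (x, y))))
    (hu : ∀ (g : ∀ w : {w : {w : InfinitePlace L // IsComplex w} // p w}, ↥(archLocal L 3 (Matrix.diagonal α) w.1))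
      (y : ∀ w' : {w : {w : InfinitePlace L // IsComplex w} // ¬ p w}, ↥(archLocal L 3 (Matrix.diagonal α) w'.1)),
      u ((archPiEquivCM 3 L (Matrix.diagonal α)).symm
        ((MeasurableEquiv.piEquivPiSubtypeProd (fun w : {w : InfinitePlace L // IsComplex w} => ↥(archLocal L 3 (Matrix.diagonal α) w)) p).symm
          (fun w => g w * gprimeBlockAt L α w.1 S' (c w.1) * (g w)⁻¹, y))) =
      u ((archPiEquivCM 3 L (Matrix.diagonal α)).symm
        ((MeasurableEquiv.piEquivPiSubtypeProd (fun w : {w : InfinitePlace L // IsComplex w} => ↥(archLocal L 3 (Matrix.diagonal α) w)) p).symm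
          (fun w => gprimeBlockAt L α w.1 S' (c w.1), y)))) :
    chartOrbG L α ν' S' a' c =
      (∏ w : {w : {w : InfinitePlace L // IsComplex w} // p w}, chartOrbGLoc L α w.1 S' (ν'w w.1) (bw w) (c w.1)) *
        ((∏ w' : {w : {w : InfinitePlace L // IsComplex w} // ¬ p w}, ((t w'.1 (chartBoxImgGLoc L α w'.1 S')).toReal : ℂ)) *
          ∫ b' : (∀ w' : {w : {w : InfinitePlace L // IsComplex w} // ¬ p w}, ↥(archLocal L 3 (Matrix.diagonal α) w'.1) ⧸ chartTorusGLoc L α w'.1 S'),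
            u ((archPiEquivCM 3 L (Matrix.diagonal α)).symm
              ((MeasurableEquiv.piEquivPiSubtypeProd (fun w : {w : InfinitePlace L // IsComplex w} => ↥(archLocal L 3 (Matrix.diagonal α) w)) p).symm
                (fun w => gprimeBlockAt L α w.1 S' (c w.1),
                  fun w' => descConj (gprimeBlockAt L α w'.1 S' (c w'.1)) (chartTorusGLoc L α w'.1 S') (forall_mem_chartTorusGLoc_comm L α w'.1 S' (c w'.1)) id (b' w'))))
            ∂(Measure.pi fun w' : {w : {w : InfinitePlace L // IsComplex w} // ¬ p w} =>
                quotientMeasure (chartTorusGLoc L α w'.1 S') (t w'.1) (isClosed_chartTorusGLoc L α w'.1 S') (ν'w w'.1))) := by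
  rw [chartOrbG_eq_prod_mul_integral_pi_mul_integral_of_tensor L α S' ν'w ν' hν t p hα hS' hp hc ha'c ha's (fun x => ∏ w, bw w (x w)) u hf hu,
    integral_pi_prod_conj_eq_prod_chartOrbGLoc L α S' ν'w p hα hS' hp c bw hbw]
  ring

end TensorLoc

end Literature.NumberTheory.Automorphic.UnitaryGroup

end
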